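import Summits.ValiantsHypothesis.ValiantsHypothesis.Theorems.LacunarySymmetroidMatrixDescartesCensusTwistedRolle

/-!
# `MatrixDescartes` census — C26 §H0(c): an END KILL AT A DEFECT loses no positive zero (block Newton cone, part 1)

HONEST FRAMING.  Object-search cell `pub-symmetroid`, route crux `Theses.LacunarySymmetroid.MatrixDescartes`
(ledger item stmt-ValiantsHypothesis-18050).  The cell's C26 «block Newton cone» (theory-3 PROOFS.md §H, H0–H2, H5;
signed referee g18; two derivations) sharpens the Rolle count behind C25 for polynomials with a DEFECT (an
equal-sign adjacent pair of coefficients): killing an END term that sits on a defect costs no positive zero.  This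
file is the kernel version of that first lemma, §H0(c), bottom end (the top end is the same statement for the
reversed polynomial and is NOT typed here):

* `card_posRoots_le_card_posRoots_derivative_of_initial_growth` — Rolle with one free extra zero: if `g(0) ≠ 0`
  and `g` moves away from `0` right after `0` (below its first positive root), then `#Z₊(g) ≤ #Z₊(g′)`
  (interior extremum on `(0, r₁)` + Rolle in each gap);
* `card_posRoots_le_card_posRoots_twist_of_bottom_defect` — for a fewnomial `f = ∑ₜ cₜ X^{eₜ}` with `c₀ c₁ > 0`:
  `#Z₊(f) ≤ #Z₊(X f′ − e₀ f)` (the Euler twist killing the bottom term), versus `… + 1` in the plain twisted Rolle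
  `card_posRoots_le_card_posRoots_twist_succ`; via `f = X^{e₀} g`, `X f′ − e₀ f = X^{e₀+1} g′` (`posRoots_X_pow_mul`).

What is NOT here: the top-end version, the sign bookkeeping H0(b), the reduction inequality H
(`Z(R_S) ≥ Z(f) − (n − k) + D_out(S)`), the block cone H1 and the level-4 statements H5 — i.e. nothing yet that the
H5 certificates («ζ ≤ 18 at relaxation level») could cite; and nothing about the crux `MatrixDescartes` or `VP ≠ VNP`.

[folklore] Rolle's theorem and the extreme value theorem; the statement is theory-3's §H0(c) (elementary).
-/

-- `Summit.ValiantsHypothesis.ValiantsHypothesis.…` repeats a component by the D-0017 layout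
-- (single-conjunct summit), which the `dupNamespace` linter flags; the name is mandated.
set_option linter.dupNamespace false

namespace Summit.ValiantsHypothesis.ValiantsHypothesis.Theorems.LacunarySymmetroidMatrixDescartes.Census

open Polynomial Finset
open scoped BigOperators Polynomial

/-- **Rolle with a free extra zero below the first root.**  If a real polynomial `g` satisfies
`g(0) ≠ 0` and moves AWAY from zero right after `0` — there is `x₁ > 0` below every positive root with
`g(0)·(g(x₁) − g(0)) > 0` — then `g′` has at least as many distinct positive roots as `g`
(one in `(0, r₁)` by the interior extremum, one in each gap by Rolle). [folklore] -/
theorem card_posRoots_le_card_posRoots_derivative_of_initial_growth (g : ℝ[X]) (x₁ : ℝ) (hx₁ : 0 < x₁)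
    (hbelow : ∀ r ∈ g.roots.toFinset.filter (fun x => 0 < x), x₁ < r)
    (hgrow : 0 < g.eval 0 * (g.eval x₁ - g.eval 0)) :
    (g.roots.toFinset.filter (fun x => 0 < x)).card ≤
      (g.derivative.roots.toFinset.filter (fun x => 0 < x)).card := by
  have hg0 : g.eval 0 ≠ 0 := by
    intro h; rw [h, zero_mul] at hgrow; exact lt_irrefl _ hgrow
  have hg : g ≠ 0 := by rintro rfl; simp at hg0
  by_cases hd : g.derivative = 0
  · -- `g` is constant: no roots at all
    rw [eq_C_of_derivative_eq_zero hd] at hgrow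
    simp at hgrow
  set S := g.roots.toFinset.filter (fun x => 0 < x) with hS
  set T := g.derivative.roots.toFinset.filter (fun x => 0 < x) with hT
  -- work with `s = insert 0 S`
  have h0S : (0 : ℝ) ∉ S := by simp [hS]
  have hcard : (insert (0 : ℝ) S).card = S.card + 1 := Finset.card_insert_of_notMem h0S
  suffices h : (insert (0 : ℝ) S).card ≤ T.card + 1 by omega
  refine Finset.card_le_of_interleaved fun x hx y hy hxy hgap => ?_
  rw [Finset.mem_insert] at hx hy
  have memS : ∀ {z}, z ∈ S ↔ (g.eval z = 0 ∧ 0 < z) := by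
    intro z; simp [hS, Multiset.mem_toFinset, mem_roots hg, IsRoot.def]
  have memT : ∀ {z}, z ∈ T ↔ (g.derivative.eval z = 0 ∧ 0 < z) := by
    intro z; simp [hT, Multiset.mem_toFinset, mem_roots hd, IsRoot.def]
  rcases hy with rfl | hyS
  · -- y = 0 is impossible since x < y and x ∈ insert 0 S has x ≥ 0
    exfalso
    rcases hx with rfl | hxS
    · exact lt_irrefl _ hxy
    · exact (lt_asymm (memS.mp hxS).2) hxy
  obtain ⟨hy0, hypos⟩ := memS.mp hyS
  rcases hx with rfl | hxS
  · -- the gap `(0, y)` with `y` the smallest positive root: interior extremum of `σ g`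
    have hx₁y : x₁ < y := hbelow y hyS
    -- maximise σ·g on [0, y]
    set σ := g.eval 0 with hσ
    obtain ⟨ξ, hξmem, hξmax⟩ := isCompact_Icc.exists_isMaxOn (Set.nonempty_Icc.mpr hypos.le)
      ((continuous_const.mul g.continuous).continuousOn : ContinuousOn (fun u => σ * g.eval u) (Set.Icc 0 y))
    have hξx₁ : σ * g.eval x₁ ≤ σ * g.eval ξ := hξmax ⟨hx₁.le, hx₁y.le⟩
    have hgrow' : σ * g.eval 0 < σ * g.eval x₁ := by
      have : 0 < σ * g.eval x₁ - σ * g.eval 0 := by rw [← mul_sub]; exact hgrow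
      linarith
    have hξ0 : ξ ≠ 0 := by
      rintro rfl; linarith
    have hξy : ξ ≠ y := by
      rintro rfl
      rw [hy0, mul_zero] at hξx₁
      have : 0 < σ * g.eval 0 := by rw [hσ]; exact mul_self_pos.mpr hg0
      linarith
    have hξint : ξ ∈ Set.Ioo 0 y := ⟨lt_of_le_of_ne hξmem.1 (Ne.symm hξ0), lt_of_le_of_ne hξmem.2 hξy⟩
    have hlocal : IsLocalMax (fun u => σ * g.eval u) ξ :=
      hξmax.isLocalMax (Icc_mem_nhds hξint.1 hξint.2)
    have hderiv : HasDerivAt (fun u => σ * g.eval u) (σ * g.derivative.eval ξ) ξ :=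
      (g.hasDerivAt ξ).const_mul σ
    have hzero := hlocal.hasDerivAt_eq_zero hderiv
    have hσ0 : σ ≠ 0 := hg0
    have hder0 : g.derivative.eval ξ = 0 := by
      rcases mul_eq_zero.mp hzero with h | h
      · exact absurd h hσ0
      · exact h
    exact ⟨ξ, memT.mpr ⟨hder0, hξint.1⟩, hξint.1, hξint.2⟩
  · -- a gap between two consecutive positive roots: plain Rolle
    obtain ⟨hx0, hxpos⟩ := memS.mp hxS
    obtain ⟨z, hz, hz'⟩ := exists_deriv_eq_zero hxy g.continuousOn (hx0.trans hy0.symm)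
    refine ⟨z, memT.mpr ⟨?_, hxpos.trans hz.1⟩, hz.1, hz.2⟩
    rwa [g.deriv] at hz'


/-- Positive roots are unchanged by a monomial factor: `Z₊(X^k · p) = Z₊(p)` (as finsets). [folklore] -/
theorem posRoots_X_pow_mul (k : ℕ) (p : ℝ[X]) (hp : p ≠ 0) :
    ((X ^ k * p).roots.toFinset.filter (fun x => 0 < x)) = (p.roots.toFinset.filter (fun x => 0 < x)) := by
  rw [roots_mul (mul_ne_zero (pow_ne_zero _ X_ne_zero) hp), roots_X_pow, Multiset.toFinset_add,
    Finset.filter_union]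
  have : ((k • ({0} : Multiset ℝ)).toFinset.filter (fun x => 0 < x)) = ∅ := by
    refine Finset.filter_eq_empty_iff.mpr fun x hx => ?_
    rw [Multiset.mem_toFinset] at hx
    have := Multiset.mem_of_mem_nsmul hx
    rw [Multiset.mem_singleton] at this
    rw [this]; exact lt_irrefl 0
  rw [this, Finset.empty_union]

/-- **H0(c) — an END KILL AT A DEFECT LOSES NO POSITIVE ZERO** (theory-3 PROOFS.md §H, signed referee g18; the
first lemma of the block Newton cone C26).  For a fewnomial `f = ∑_{t} cₜ X^{eₜ}` (`e` strictly increasing) whose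
two LOWEST coefficients have the same sign (`c₀ c₁ > 0`, a «defect» at the bottom end), the Euler twist killing the
bottom term, `X f′ − e₀ f = ∑_{t ≥ 1} cₜ (eₜ − e₀) X^{eₜ}`, has at least as many distinct positive roots as `f`
(not one fewer as in plain Rolle `card_posRoots_le_card_posRoots_twist_succ`): `φ = f / x^{e₀}` starts at `c₀ ≠ 0`
and initially moves away from `0`, so it has an interior extremum before its first positive zero. [folklore] -/
theorem card_posRoots_le_card_posRoots_twist_of_bottom_defect {n : ℕ} (e : Fin (n + 2) → ℕ) (he : StrictMono e)
    (c : Fin (n + 2) → ℝ) (h01 : 0 < c 0 * c 1) :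
    ((∑ t, C (c t) * X ^ (e t)).roots.toFinset.filter (fun x => 0 < x)).card ≤
      ((X * derivative (∑ t, C (c t) * X ^ (e t)) - C ((e 0 : ℕ) : ℝ) * (∑ t, C (c t) * X ^ (e t))
        ).roots.toFinset.filter (fun x => 0 < x)).card := by
  have hc0 : c 0 ≠ 0 := by intro h; rw [h, zero_mul] at h01; exact lt_irrefl _ h01
  have hc1 : c 1 ≠ 0 := by intro h; rw [h, mul_zero] at h01; exact lt_irrefl _ h01
  have he0 : ∀ t, e 0 ≤ e t := fun t => he.monotone (Fin.zero_le _)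
  have h01e : e 0 < e 1 := he Fin.zero_lt_one
  have he1 : ∀ t : Fin (n + 2), t ≠ 0 → e 1 ≤ e t := by
    intro t ht
    apply he.monotone
    rw [Fin.le_def]
    have : t.val ≠ 0 := fun h => ht (Fin.ext h)
    simp only [Fin.val_one]
    omega
  have he1' : ∀ t : Fin (n + 2), t ≠ 0 → t ≠ 1 → e 1 < e t := by
    intro t ht ht1
    apply he
    rw [Fin.lt_def]
    have h0 : t.val ≠ 0 := fun h => ht (Fin.ext h)
    have h1 : t.val ≠ 1 := fun h => ht1 (Fin.ext h)
    simp only [Fin.val_one]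
    omega
  -- `f = X^{e₀} · g`, `X f′ − e₀ f = X^{e₀+1} · g′`
  set g : ℝ[X] := ∑ t, C (c t) * X ^ (e t - e 0) with hg
  have hf : (∑ t, C (c t) * X ^ (e t)) = X ^ (e 0) * g := by
    rw [hg, Finset.mul_sum]
    refine Finset.sum_congr rfl fun t _ => ?_
    rw [mul_left_comm, ← pow_add, Nat.add_sub_cancel' (he0 t)]
  have hg0 : g.eval 0 = c 0 := by
    rw [hg, eval_finsetSum, Finset.sum_eq_single (0 : Fin (n + 2))]
    · simp
    · intro t _ ht
      have : e t - e 0 ≠ 0 := by have := he1 t ht; omega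
      simp [zero_pow this]
    · intro h; exact absurd (Finset.mem_univ _) h
  have hgne : g ≠ 0 := fun h => hc0 (by rw [← hg0, h, eval_zero])
  have htw : X * derivative (∑ t, C (c t) * X ^ (e t)) - C ((e 0 : ℕ) : ℝ) * (∑ t, C (c t) * X ^ (e t))
      = X ^ (e 0 + 1) * derivative g := by
    rw [twist_sum_C_mul_X_pow, hg, derivative_sum, Finset.mul_sum]
    refine Finset.sum_congr rfl fun t _ => ?_
    rw [derivative_C_mul_X_pow]
    by_cases ht : t = 0
    · subst ht; simp
    · have h1 : 1 ≤ e t - e 0 := by have := he1 t ht; omega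
      rw [mul_left_comm, ← pow_add, Nat.cast_sub (he0 t), show e 0 + 1 + (e t - e 0 - 1) = e t by omega]
  rw [htw, hf, posRoots_X_pow_mul _ _ hgne]
  by_cases hd : derivative g = 0
  · rw [eq_C_of_derivative_eq_zero hd]
    simp
  rw [posRoots_X_pow_mul _ _ hd]
  -- the set of positive roots of `g`; trivial if empty
  set S := g.roots.toFinset.filter (fun x => 0 < x) with hS
  by_cases hSe : S = ∅
  · rw [hSe]; simp
  have hSne : S.Nonempty := Finset.nonempty_iff_ne_empty.mpr hSe
  set r := S.min' hSne with hr
  have hrS : r ∈ S := Finset.min'_mem _ _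
  have hr0 : 0 < r := (Finset.mem_filter.mp hrS).2
  -- `g = C c₀ + X^{m} · hp` with `hp(0) = c₁`, `m = e₁ − e₀ ≥ 1`
  set hp : ℝ[X] := ∑ t ∈ Finset.univ.erase 0, C (c t) * X ^ (e t - e 1) with hhp
  have hgsplit : g = C (c 0) + X ^ (e 1 - e 0) * hp := by
    rw [hg, hhp, ← Finset.add_sum_erase _ _ (Finset.mem_univ (0 : Fin (n + 2))), Finset.mul_sum]
    congr 1
    · simp
    · refine Finset.sum_congr rfl fun t ht => ?_
      have ht0 : t ≠ 0 := Finset.ne_of_mem_erase ht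
      rw [mul_left_comm, ← pow_add]
      congr 2
      have := he1 t ht0; omega
  have hp0 : hp.eval 0 = c 1 := by
    rw [hhp, eval_finsetSum, Finset.sum_eq_single (1 : Fin (n + 2))]
    · simp
    · intro t ht ht1
      have : e t - e 1 ≠ 0 := by have := he1' t (Finset.ne_of_mem_erase ht) ht1; omega
      simp [zero_pow this]
    · intro h
      exfalso; apply h
      exact Finset.mem_erase.mpr ⟨ne_of_gt Fin.zero_lt_one, Finset.mem_univ _⟩
  -- continuity of `hp` at `0`: `hp` keeps the sign of `c₁` on `|x| < δ`
  obtain ⟨δ, hδ, hδp⟩ := Metric.continuousAt_iff.mp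
    (hp.continuous.continuousAt : ContinuousAt (fun x => hp.eval x) (0 : ℝ)) |c 1| (abs_pos.mpr hc1)
  set x₁ := min (δ / 2) (r / 2) with hx₁
  have hx₁pos : 0 < x₁ := lt_min (by linarith) (by linarith)
  have hx₁δ : dist x₁ 0 < δ := by
    rw [Real.dist_eq, sub_zero, abs_of_pos hx₁pos]; exact lt_of_le_of_lt (min_le_left _ _) (by linarith)
  have hx₁r : x₁ < r := lt_of_le_of_lt (min_le_right _ _) (by linarith)
  have hsign : 0 < c 1 * hp.eval x₁ := by
    have h := hδp hx₁δ
    rw [hp0, Real.dist_eq] at h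
    obtain ⟨h1, h2⟩ := abs_sub_lt_iff.mp h
    rcases lt_or_gt_of_ne hc1 with hc | hc
    · rw [abs_of_neg hc] at h1 h2; nlinarith
    · rw [abs_of_pos hc] at h1 h2; nlinarith
  refine card_posRoots_le_card_posRoots_derivative_of_initial_growth g x₁ hx₁pos ?_ ?_
  · intro y hy
    exact lt_of_lt_of_le hx₁r (Finset.min'_le _ _ hy)
  · have hm0 : e 1 - e 0 ≠ 0 := by omega
    have hev : g.eval x₁ - g.eval 0 = x₁ ^ (e 1 - e 0) * hp.eval x₁ := by
      rw [hgsplit]; simp [hm0]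
    rw [hev, hg0]
    have hm : 0 < x₁ ^ (e 1 - e 0) := pow_pos hx₁pos _
    have hprod : 0 < (c 0 * c 1) * (c 1 * hp.eval x₁) := mul_pos h01 hsign
    have hc1sq : 0 < c 1 ^ 2 := by positivity
    have : c 0 * (x₁ ^ (e 1 - e 0) * hp.eval x₁) = ((c 0 * c 1) * (c 1 * hp.eval x₁)) * x₁ ^ (e 1 - e 0) / c 1 ^ 2 := by
      field_simp
    rw [this]
    positivity


/-! ## Appended 2026-08-23 (typer gen 4): the TOP end of §H0(c) by reversal
The module docstring above says the top-end version is not typed; it now is: `card_posRoots_sum_reverse` (`x ↦ x⁻¹`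
keeps the number of positive roots of `∑ cₜ X^{aₜ}` ↦ `∑ cₜ X^{N − aₜ}`) and `card_posRoots_le_card_posRoots_twist_of_top_defect`
(`c_{n+1} c_n > 0 ⇒ #Z₊(f) ≤ #Z₊(X f′ − e_{n+1} f)`).  Still NOT here: H0(b), H, H1, H5. -/


/-- **Reversal keeps the number of positive roots.**  For exponents `a t ≤ N`,
`#Z₊(∑ cₜ X^{aₜ}) = #Z₊(∑ cₜ X^{N − aₜ})` (`x ↦ x⁻¹` on the positive roots). [folklore] -/
theorem card_posRoots_sum_reverse {n : ℕ} (c : Fin n → ℝ) (a : Fin n → ℕ) (N : ℕ) (ha : ∀ t, a t ≤ N) :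
    ((∑ t, C (c t) * X ^ (a t)).roots.toFinset.filter (fun x => 0 < x)).card =
      ((∑ t, C (c t) * X ^ (N - a t)).roots.toFinset.filter (fun x => 0 < x)).card := by
  -- evaluation identity: q(x) = x^N · p(x⁻¹) for x ≠ 0, and symmetrically
  have key : ∀ (b : Fin n → ℕ) (x : ℝ), x ≠ 0 → (∀ t, b t ≤ N) →
      (∑ t, C (c t) * X ^ (N - b t)).eval x = x ^ N * (∑ t, C (c t) * X ^ (b t)).eval x⁻¹ := by
    intro b x hx hb
    rw [eval_finsetSum, eval_finsetSum, Finset.mul_sum]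
    refine Finset.sum_congr rfl fun t _ => ?_
    simp only [eval_mul, eval_C, eval_pow, eval_X]
    have hxb : x ^ (b t) ≠ 0 := pow_ne_zero _ hx
    have hpow : x ^ (N - b t) = x ^ N / x ^ (b t) := by
      rw [eq_div_iff hxb, ← pow_add, Nat.sub_add_cancel (hb t)]
    rw [hpow, inv_pow]
    field_simp
  -- if one side is the zero polynomial, so is the other
  have zero_iff : ∀ (b : Fin n → ℕ), (∀ t, b t ≤ N) →
      (∑ t, C (c t) * X ^ (b t)) = 0 → (∑ t, C (c t) * X ^ (N - b t)) = 0 := by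
    intro b hb h0
    apply Polynomial.eq_zero_of_infinite_isRoot
    apply Set.infinite_of_injective_forall_mem (f := fun k : ℕ => ((k : ℝ) + 1))
    · intro i j hij; simpa using hij
    · intro k
      show IsRoot _ _
      rw [IsRoot.def, key b _ (by positivity) hb, h0, eval_zero, mul_zero]
  have hsymm : ∀ t, N - (N - a t) = a t := fun t => Nat.sub_sub_self (ha t)
  by_cases hp : (∑ t, C (c t) * X ^ (a t)) = 0
  · rw [hp, zero_iff a ha hp]
  have hq : (∑ t, C (c t) * X ^ (N - a t)) ≠ 0 := by
    intro h0
    apply hp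
    have := zero_iff (fun t => N - a t) (fun t => Nat.sub_le _ _) h0
    simpa only [hsymm] using this
  -- bijection x ↦ x⁻¹
  refine Finset.card_bij (fun x _ => x⁻¹) ?_ ?_ ?_
  · intro x hx
    simp only [Finset.mem_filter, Multiset.mem_toFinset, mem_roots hp, IsRoot.def] at hx
    simp only [Finset.mem_filter, Multiset.mem_toFinset, mem_roots hq, IsRoot.def]
    refine ⟨?_, inv_pos.mpr hx.2⟩
    rw [key a _ (inv_ne_zero hx.2.ne') ha, inv_inv, hx.1, mul_zero]
  · intro x hx y hy hxy
    exact inv_injective hxy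
  · intro y hy
    simp only [Finset.mem_filter, Multiset.mem_toFinset, mem_roots hq, IsRoot.def] at hy
    refine ⟨y⁻¹, ?_, inv_inv y⟩
    simp only [Finset.mem_filter, Multiset.mem_toFinset, mem_roots hp, IsRoot.def]
    refine ⟨?_, inv_pos.mpr hy.2⟩
    have h := hy.1
    rw [key a _ hy.2.ne' ha] at h
    rcases mul_eq_zero.mp h with h1 | h1
    · exact absurd h1 (pow_ne_zero _ hy.2.ne')
    · exact h1


/-- **H0(c), TOP end** (theory-3 PROOFS.md §H0(c), second clause): for a fewnomial `f = ∑ₜ cₜ X^{eₜ}` (`e` strictly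
increasing on `Fin (n+2)`) whose two HIGHEST coefficients have the same sign (`c_{n+1} c_n > 0`; indices written
`Fin.rev 0 = Fin.last`, `Fin.rev 1`), the Euler twist killing the TOP term, `X f′ − e_{n+1} f`, has at least as many
distinct positive roots as `f`.  Proof: reversal `x ↦ x⁻¹` (`card_posRoots_sum_reverse`) turns the top end into the
bottom end of `∑ₜ cₜ X^{N − eₜ}`, `N = e_{n+1}`, and `card_posRoots_le_card_posRoots_twist_of_bottom_defect` applies. [folklore] -/
theorem card_posRoots_le_card_posRoots_twist_of_top_defect {n : ℕ} (e : Fin (n + 2) → ℕ) (he : StrictMono e)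
    (c : Fin (n + 2) → ℝ) (htop : 0 < c (Fin.rev 0) * c (Fin.rev 1)) :
    ((∑ t, C (c t) * X ^ (e t)).roots.toFinset.filter (fun x => 0 < x)).card ≤
      ((X * derivative (∑ t, C (c t) * X ^ (e t)) - C ((e (Fin.last (n + 1)) : ℕ) : ℝ) * (∑ t, C (c t) * X ^ (e t))
        ).roots.toFinset.filter (fun x => 0 < x)).card := by
  set N := e (Fin.last (n + 1)) with hN
  have heN : ∀ t, e t ≤ N := fun t => he.monotone (Fin.le_last t)
  set e' : Fin (n + 2) → ℕ := fun s => N - e (Fin.rev s) with he'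
  set c' : Fin (n + 2) → ℝ := fun s => c (Fin.rev s) with hc'
  have he's : StrictMono e' := by
    intro s s' hss'
    have hlt : Fin.rev s' < Fin.rev s := Fin.rev_lt_rev.mpr hss'
    have h1 := he hlt
    have h2 := heN (Fin.rev s)
    have h3 := heN (Fin.rev s')
    show N - e (Fin.rev s) < N - e (Fin.rev s')
    omega
  have h01 : 0 < c' 0 * c' 1 := by simpa only [hc'] using htop
  have hb := card_posRoots_le_card_posRoots_twist_of_bottom_defect e' he's c' h01
  rw [twist_sum_C_mul_X_pow] at hb
  -- identify the reversed sums
  have hre : (∑ s, C (c' s) * X ^ (e' s)) = ∑ t, C (c t) * X ^ (N - e t) := by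
    simp only [hc', he']
    exact Equiv.sum_comp Fin.revPerm (fun t => C (c t) * X ^ (N - e t))
  have he'0 : ((e' 0 : ℕ) : ℝ) = 0 := by
    have : e' 0 = 0 := by
      show N - e (Fin.rev 0) = 0
      rw [Fin.rev_zero, ← hN, Nat.sub_self]
    rw [this, Nat.cast_zero]
  have hre2 : (∑ s, C (c' s * ((e' s : ℝ) - (e' 0 : ℝ))) * X ^ (e' s))
      = ∑ t, C (c t * ((N : ℝ) - (e t : ℝ))) * X ^ (N - e t) := by
    simp only [he'0, sub_zero]
    have step : (∑ s, C (c' s * ((e' s : ℕ) : ℝ)) * X ^ (e' s))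
        = ∑ t, C (c t * (((N - e t : ℕ) : ℝ))) * X ^ (N - e t) := by
      simp only [hc', he']
      exact Equiv.sum_comp Fin.revPerm (fun t => C (c t * (((N - e t : ℕ) : ℝ))) * X ^ (N - e t))
    rw [step]
    refine Finset.sum_congr rfl fun t _ => ?_
    rw [Nat.cast_sub (heN t)]
  have h1 := card_posRoots_sum_reverse c e N heN
  have h3 := card_posRoots_sum_reverse (fun t => c t * ((N : ℝ) - (e t : ℝ))) e N heN
  have h4 : (∑ t, C (c t * ((N : ℝ) - (e t : ℝ))) * X ^ (e t))
      = -(X * derivative (∑ t, C (c t) * X ^ (e t)) - C ((N : ℕ) : ℝ) * (∑ t, C (c t) * X ^ (e t))) := by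
    rw [twist_sum_C_mul_X_pow, ← Finset.sum_neg_distrib]
    refine Finset.sum_congr rfl fun t _ => ?_
    rw [← neg_mul, ← C_neg]
    congr 2
    ring
  rw [hre, hre2] at hb
  rw [h1]
  refine hb.trans ?_
  rw [← h3, h4, roots_neg]

end Summit.ValiantsHypothesis.ValiantsHypothesis.Theorems.LacunarySymmetroidMatrixDescartes.Census
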